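import Literature.IUT.HodgeTheaters.InitialThetaDataQRootProofs
import Literature.NumberTheory.EllipticCurves.TateCurve.SplitOfOddTorsion
import Literature.NumberTheory.EllipticCurves.MultiplicativeReductionBaseChangeTorsionProofs
import Literature.NumberTheory.EllipticCurves.MultiplicativeReductionJValuationProofs
import HarnessLib

/-!
# Initial Θ-data: `E_K = E_F ×_F K` has SPLIT multiplicative reduction over `V^bad`
# ([IUTchI] Def. 3.1 (b)(c) ⟹ "`E_v` is a Tate curve over `K_v̲`", the standing hypothesis of
# [EtTh] §1 / [IUTchI] Example 3.2 at the bad places)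

`Proofs` companion (theorems only; no definitions, no named facts, no instances) of
`Literature.IUT.HodgeTheaters.InitialThetaData` (abc-iut-L5-t2: the REAL [IUTchI] Def. 3.1), by the
cell `abc-iut` (seat abc-iut-L5-t12). Mochizuki, *Inter-universal Teichmüller theory I* (kurims
May-2020 manuscript), Def. 3.1 (b) p. 61 "`X_F` has bad [i.e., multiplicative] reduction at the
elements of `V(F)` that lie over `V^bad_mod`", (c) p. 62 "`K := F(E_F[l])`", and Example 3.2 p. 69
("`X̲_v … the once-punctured elliptic curve `E_v` over `K_v` … `q_v` the `q`-parameter") — which,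
like [EtTh] §1 ("stable log curve … whose special fibre is … SPLIT"), treats `E_v := E_F ×_F K_v̲`
at `v̲ ∈ V̲^bad` as a Tate curve over `K_v̲`, i.e. as having SPLIT multiplicative reduction. Print
gives only "multiplicative" in Def. 3.1 (b); splitness over `K_v̲` is the classical consequence of
the rational odd-order torsion of Def. 3.1 (c) (`E_F[l] ⊆ E_F(K)`, `l ≥ 5`), by the tree's
`SplitOfOddTorsion` (Silverman ATAEC Thm. V.5.3 / Cor. V.5.4: on a non-split multiplicative curve
at most `n` rational points are killed by an odd `n`). This file performs that discharge:

* `hasSplitMultiplicativeReductionAt_baseChange_of_odd_torsion` (generic, no Θ-data): `E/F`,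
  `K ⊇ F` number fields, `w` a finite place of `K` with `|j(E_K)|_w > 1`, more than `n` points of
  `E(K)` killed by an odd `n` ⟹ `E_K` has split multiplicative reduction at `w`; and
  `…_of_hasMultiplicativeReductionAt_of_odd_torsion`, the same from multiplicative reduction of `E`
  at the place `v` of `F` under `w` (abc-iut-w5-d158's
  `one_lt_valuation_j_baseChange_of_hasMultiplicativeReductionAt`, Silverman AEC VII.5.1 (b)).
* `InitialThetaData.hasSplitMultiplicativeReductionAt_of_one_lt_valuation` /
  `…_of_liesOver` / **`…_of_mem_VFbad`** — for `D : InitialThetaData F K Fbar E l Pb`: at every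
  finite place `w` of `K` lying over `V(F)^bad = V^bad_mod ×_{V_mod} V(F)` the curve `E_K` has
  SPLIT multiplicative reduction (the `l² > l` points of `E_F(K)` killed by the odd prime `l` are
  abc-iut-w5-d209's `InitialThetaData.exists_finset_l_torsion`).
* **`InitialThetaData.exists_pow_two_mul_l_eq_tateParameter_of_liesOver` / `…_of_mem_VFbad`** —
  abc-iut-w5-d209's [IUTchI] Ex. 3.2 (iv) theorem `exists_pow_two_mul_l_eq_tateParameter`
  ("`q_v` admits a `2l`-th root in `K_v̲`") with its hypothesis `hsplit` DISCHARGED: at every place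
  of `K` over `V(F)^bad`, `q_w = r^{2l}` in `K_w` with `w(j(E_F)) = (w r)⁻¹ ^ (2l)`.
* (v2 append) `InitialThetaData.hasMultiplicativeReductionAt_of_liesOver` and
  **`InitialThetaData.log_valued_tateParameter_eq_neg_ordMinimalDiscriminant_of_liesOver`** —
  `ord_w(q_w) = ord_w(Δ_min(E_K))` for THE (unique) Tate parameter at the places of `K` over
  `V(F)^bad`: the root form and abc-iut-L5-t2's valuation form (`two_mul_l_dvd_ordMinimalDiscriminant`)
  of Ex. 3.2 (iv) concern the same integer.

Nothing of the series is asserted; no side is taken on [IUTchIII] Cor. 3.12.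

## References
* [Mochizuki2012] S. Mochizuki, IUT I, Def. 3.1 (b)(c) pp. 61–62, Example 3.2 (iv) p. 71.
* [SilvermanATAEC1994] J. H. Silverman, *Advanced Topics in the Arithmetic of Elliptic Curves*,
  GTM 151, Thm. V.5.3 and Cor. V.5.4 (PDF pp. 407–410).
* [SilvermanAEC2009] J. H. Silverman, *The Arithmetic of Elliptic Curves*, 2nd ed., VII.5 Prop. 5.1.
-/

noncomputable section

open scoped Classical
open WeierstrassCurve

namespace Literature.IUT.HodgeTheaters

open Literature.NumberTheory.EllipticCurves Literature.NumberTheory.EllipticCurves.TateCurve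
  NumberField IsDedekindDomain

/-! ### Generic: base change `E_K` of a curve over `F`, points over `K` -/

section Generic

variable {F K : Type} [Field F] [NumberField F] [Field K] [NumberField K] [Algebra F K]
  (E : WeierstrassCurve F) [E.IsElliptic] (w : HeightOneSpectrum (𝓞 K))

/-- Transport of a finset of points killed by `n` along an EQUALITY of Weierstrass curves. [folklore] -/
private theorem exists_finset_torsion_of_eq' {L : Type*} [Field L] {W₁ W₂ : WeierstrassCurve L}
    (h : W₁ = W₂) {n : ℕ} (S : Finset W₁.toAffine.Point) (hS : ∀ P ∈ S, n • P = 0) :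
    ∃ S' : Finset W₂.toAffine.Point, S'.card = S.card ∧ ∀ P ∈ S', n • P = 0 := by
  subst h
  exact ⟨S, rfl, hS⟩

omit [NumberField F] [E.IsElliptic] in
/-- Push-forward of a finset of `K`-points killed by `n` to the completion `K_w`, as points of
`(E_F ×_F K) ×_K K_w` (injective homomorphism `E_F(K) → E_F(K_w)`; the curves `E_F ×_F K_w` and
`(E_F ×_F K) ×_K K_w` coincide). Same device as in abc-iut-w5-d209's `InitialThetaDataQRootProofs`
(private there). [folklore] -/
private theorem exists_finset_torsion_completion' {n : ℕ}
    (S : Finset (E.toAffine.baseChange K).Point) (hS : ∀ P ∈ S, n • P = 0) :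
    ∃ S' : Finset ((E.baseChange K).baseChange (w.adicCompletion K)).toAffine.Point,
      S'.card = S.card ∧ ∀ P ∈ S', n • P = 0 := by
  let f : K →ₐ[F] w.adicCompletion K := IsScalarTower.toAlgHom F K (w.adicCompletion K)
  let ι : (E.toAffine.baseChange K).Point →+ (E.toAffine.baseChange (w.adicCompletion K)).Point :=
    Affine.Point.map f
  have hι : Function.Injective ι := Affine.Point.map_injective f
  have hEq : E.baseChange (w.adicCompletion K) = (E.baseChange K).baseChange (w.adicCompletion K) := by
    rw [WeierstrassCurve.baseChange, WeierstrassCurve.baseChange, WeierstrassCurve.baseChange,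
      WeierstrassCurve.map_map, ← IsScalarTower.algebraMap_eq]
  obtain ⟨S', hS', hS'n⟩ := exists_finset_torsion_of_eq' hEq (S.map ⟨ι, hι⟩) (by
    intro P hP
    obtain ⟨P₀, hP₀, rfl⟩ := Finset.mem_map.mp hP
    show n • ι P₀ = 0
    rw [← map_nsmul, hS P₀ hP₀, map_zero])
  exact ⟨S', by rw [hS', Finset.card_map], hS'n⟩

omit [NumberField F] in
/-- **`E_K` has split multiplicative reduction at a place `w` with `|j|_w > 1` once `E(K)` has
more than `n` points killed by an odd `n`** (the tree's
`hasSplitMultiplicativeReductionAt_of_odd_torsion_of_one_lt_valuation` at `K_w`, fed with the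
`K`-points pushed to the completion). [cite: SilvermanATAEC1994, Thm. V.5.3 and Cor. V.5.4 (PDF pp. 407–410)] -/
theorem hasSplitMultiplicativeReductionAt_baseChange_of_odd_torsion
    (hj : 1 < w.valuation K (E.baseChange K).j) {n : ℕ} (hn : Odd n)
    (S : Finset (E.toAffine.baseChange K).Point) (hS : ∀ P ∈ S, n • P = 0) (hcard : n < S.card) :
    (E.baseChange K).HasSplitMultiplicativeReductionAt w := by
  haveI : (E.baseChange K).IsElliptic := inferInstanceAs (E.map (algebraMap F K)).IsElliptic
  obtain ⟨S', hS', hS't⟩ := exists_finset_torsion_completion' E w S hS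
  exact hasSplitMultiplicativeReductionAt_of_odd_torsion_of_one_lt_valuation K w (E.baseChange K) hj
    hn S' hS't (hS' ▸ hcard)

/-- **The same from MULTIPLICATIVE reduction of `E` at the place `v` of `F` under `w`**
(`|j(E_K)|_w = |j(E)|_v^{e(w|v)} > 1`, Silverman AEC VII.5.1 (b); abc-iut-w5-d158's
`one_lt_valuation_j_baseChange_of_hasMultiplicativeReductionAt`): multiplicative reduction of `E` at
`v`, `w ∣ v`, more than `n` points of `E(K)` killed by an odd `n` ⟹ `E_K` has SPLIT multiplicative
reduction at `w`. [cite: SilvermanATAEC1994, Thm. V.5.3 and Cor. V.5.4 (PDF pp. 407–410)]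
[cite: SilvermanAEC2009, VII.5 Prop. 5.1(b)] -/
theorem hasSplitMultiplicativeReductionAt_baseChange_of_hasMultiplicativeReductionAt_of_odd_torsion
    {v : HeightOneSpectrum (𝓞 F)} [w.asIdeal.LiesOver v.asIdeal] (hmult : E.HasMultiplicativeReductionAt v)
    {n : ℕ} (hn : Odd n) (S : Finset (E.toAffine.baseChange K).Point) (hS : ∀ P ∈ S, n • P = 0)
    (hcard : n < S.card) : (E.baseChange K).HasSplitMultiplicativeReductionAt w :=
  hasSplitMultiplicativeReductionAt_baseChange_of_odd_torsion E w
    (E.one_lt_valuation_j_baseChange_of_hasMultiplicativeReductionAt (w := w) hmult) hn S hS hcard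

end Generic

/-! ### For initial Θ-data: split multiplicative reduction over `V(F)^bad`, and Example 3.2 (iv) -/

section ThetaData

variable {F K Fbar : Type} [Field F] [NumberField F] [Field K] [NumberField K] [Algebra F K]
  [Field Fbar] [Algebra F Fbar] [Algebra K Fbar] [IsScalarTower F K Fbar] {E : WeierstrassCurve F}
  [E.IsElliptic] {l : ℕ} {Pb : BadPlacePredicates K} (D : InitialThetaData F K Fbar E l Pb)

namespace InitialThetaData

include D

/-- **For initial Θ-data, `E_K` has SPLIT multiplicative reduction at every finite place `w` of
`K` with `|j(E_F)|_w > 1`**: `E_F(K) ⊇ E_F[l]` gives `l²` points killed by the odd prime `l ≥ 5`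
(Def. 3.1 (c), abc-iut-w5-d209's `exists_finset_l_torsion`), and `l² > l`.
[claim: Mochizuki2012, status: disputed] [cite: SilvermanATAEC1994, Thm. V.5.3 and Cor. V.5.4 (PDF pp. 407–410)] -/
theorem hasSplitMultiplicativeReductionAt_of_one_lt_valuation (w : HeightOneSpectrum (𝓞 K))
    (hj : 1 < w.valuation K (E.baseChange K).j) :
    (E.baseChange K).HasSplitMultiplicativeReductionAt w := by
  obtain ⟨S, hS, hSt⟩ := D.exists_finset_l_torsion
  have hl := D.l_prime
  have h5 := D.five_le_l
  have hodd : Odd l := hl.odd_of_ne_two (by omega)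
  refine hasSplitMultiplicativeReductionAt_baseChange_of_odd_torsion E w hj hodd S hSt ?_
  rw [hS, sq]
  nlinarith

/-- **For initial Θ-data, `E_K` has SPLIT multiplicative reduction at every place `w` of `K` over a
place `v` of `F` of multiplicative reduction** (Def. 3.1 (b) at `v ∈ V(F)^bad` + (c)).
[claim: Mochizuki2012, status: disputed] [cite: SilvermanATAEC1994, Thm. V.5.3 and Cor. V.5.4 (PDF pp. 407–410)] -/
theorem hasSplitMultiplicativeReductionAt_of_liesOver {v : HeightOneSpectrum (𝓞 F)}
    (w : HeightOneSpectrum (𝓞 K)) [w.asIdeal.LiesOver v.asIdeal]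
    (hmult : E.HasMultiplicativeReductionAt v) :
    (E.baseChange K).HasSplitMultiplicativeReductionAt w :=
  D.hasSplitMultiplicativeReductionAt_of_one_lt_valuation w
    (E.one_lt_valuation_j_baseChange_of_hasMultiplicativeReductionAt (w := w) hmult)

/-- **[IUTchI] Def. 3.1 (b)(c) ⟹ `E_v := E_F ×_F K_v̲` is a Tate curve at the bad places**: for
initial Θ-data `D`, every finite place `w` of `K` lying over `V(F)^bad := V^bad_mod ×_{V_mod} V(F)`
(`D.VFbad`; i.e. over `v` with `E_F` of multiplicative reduction, `multiplicative_over_VbadMod`) is a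
place of SPLIT multiplicative reduction of `E_K` — the standing "split" hypothesis of [EtTh] §1 /
Example 3.2 at `v̲ ∈ V̲^bad`, derived rather than assumed.
[claim: Mochizuki2012, status: disputed] [cite: SilvermanATAEC1994, Thm. V.5.3 and Cor. V.5.4 (PDF pp. 407–410)] -/
theorem hasSplitMultiplicativeReductionAt_of_mem_VFbad {v : FinitePlace F} (hv : v ∈ D.VFbad)
    (w : HeightOneSpectrum (𝓞 K)) [w.asIdeal.LiesOver v.maximalIdeal.asIdeal] :
    (E.baseChange K).HasSplitMultiplicativeReductionAt w :=
  D.hasSplitMultiplicativeReductionAt_of_liesOver w (D.multiplicative_over_VbadMod v hv)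

/-- **[IUTchI] Example 3.2 (iv) — `q_v` admits a `2l`-th root in `K_v̲`, UNCONDITIONALLY over the
real Def. 3.1** (abc-iut-w5-d209's `exists_pow_two_mul_l_eq_tateParameter` with its hypothesis
`hsplit` discharged by `hasSplitMultiplicativeReductionAt_of_liesOver`): for initial Θ-data `D` and
a finite place `w` of `K` over a place `v` of `F` where `E_F` has multiplicative reduction, the Tate
parameter `q_w ∈ K_w` (`q_w ≠ 0`, `‖q_w‖ < 1`, `tateJ q_w = j(E_F)`) is `r ^ (2l)` for some
`r ∈ K_w`, and `w(j(E_F)) = (w r)⁻¹ ^ (2l)`. Print: "it follows from our assumption concerning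
`2`-torsion, together with the definition of `K`, that `q_v` admits a `2l`-th root in
`𝒪^▷_{K_v}`" (p. 71). [claim: Mochizuki2012, status: disputed]
[cite: SilvermanATAEC1994, Thm. V.3.1 (c)(d) and Thm. V.5.3 (PDF pp. 395, 407–409)] -/
theorem exists_pow_two_mul_l_eq_tateParameter_of_liesOver {v : HeightOneSpectrum (𝓞 F)}
    (w : HeightOneSpectrum (𝓞 K)) [w.asIdeal.LiesOver v.asIdeal]
    (hmult : E.HasMultiplicativeReductionAt v) :
    ∃ q r : w.adicCompletion K, q ≠ 0 ∧ ‖q‖ < 1 ∧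
      tateJ q = algebraMap K (w.adicCompletion K) (E.baseChange K).j ∧ r ^ (2 * l) = q ∧
      Valued.v (algebraMap K (w.adicCompletion K) (E.baseChange K).j) = ((Valued.v r)⁻¹) ^ (2 * l) :=
  D.exists_pow_two_mul_l_eq_tateParameter w (D.hasSplitMultiplicativeReductionAt_of_liesOver w hmult)

/-- **[IUTchI] Example 3.2 (iv) at `v̲ ∈ V̲^bad`, UNCONDITIONALLY over the real Def. 3.1**: for every
finite place `w` of `K` over `V(F)^bad` (`D.VFbad`), `q_w = r ^ (2l)` in `K_w` with
`w(j(E_F)) = (w r)⁻¹ ^ (2l)`. [claim: Mochizuki2012, status: disputed]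
[cite: SilvermanATAEC1994, Thm. V.3.1 (c)(d) and Thm. V.5.3 (PDF pp. 395, 407–409)] -/
theorem exists_pow_two_mul_l_eq_tateParameter_of_mem_VFbad {v : FinitePlace F} (hv : v ∈ D.VFbad)
    (w : HeightOneSpectrum (𝓞 K)) [w.asIdeal.LiesOver v.maximalIdeal.asIdeal] :
    ∃ q r : w.adicCompletion K, q ≠ 0 ∧ ‖q‖ < 1 ∧
      tateJ q = algebraMap K (w.adicCompletion K) (E.baseChange K).j ∧ r ^ (2 * l) = q ∧
      Valued.v (algebraMap K (w.adicCompletion K) (E.baseChange K).j) = ((Valued.v r)⁻¹) ^ (2 * l) :=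
  D.exists_pow_two_mul_l_eq_tateParameter_of_liesOver w (D.multiplicative_over_VbadMod v hv)

/-- For initial Θ-data, `E_K` has (in particular) MULTIPLICATIVE reduction at every place `w` of `K`
over a place `v` of `F` of multiplicative reduction (from the SPLIT multiplicative reduction of
`hasSplitMultiplicativeReductionAt_of_liesOver`; base change of multiplicative reduction at the
places over `V(F)^bad`). [claim: Mochizuki2012, status: disputed]
[cite: SilvermanAEC2009, VII.5 Prop. 5.1(b)] -/
theorem hasMultiplicativeReductionAt_of_liesOver {v : HeightOneSpectrum (𝓞 F)}
    (w : HeightOneSpectrum (𝓞 K)) [w.asIdeal.LiesOver v.asIdeal]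
    (hmult : E.HasMultiplicativeReductionAt v) :
    (E.baseChange K).HasMultiplicativeReductionAt w :=
  (D.hasSplitMultiplicativeReductionAt_of_liesOver w hmult).hasMultiplicativeReductionAt

/-- **`ord_w(q_w) = ord_w(Δ_min(E_K))` at the places of `K` over `V(F)^bad`** (v2 append): for initial
Θ-data `D`, a place `w` of `K` over a place `v` of `F` of multiplicative reduction, and ANY
`q ∈ K_w` with `q ≠ 0`, `w(q) < 1`, `tateJ q = j(E_K)` — i.e. THE Tate parameter `q_w` of
`E_K ⊗ K_w` (it exists: abc-iut-w5-d209's / this file's `exists_pow_two_mul_l_eq_tateParameter_of_liesOver`;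
unique: Silverman ATAEC Lemma V.5.1 `tateParameter_unique`) — `log w(q) = −ord_w(Δ_min(E_K))`, the
quantity of abc-iut-L5-t2's decl of record `InitialThetaData.two_mul_l_dvd_ordMinimalDiscriminant`
([IUTchI] Ex. 3.2 (iv) valuation form). So the ROOT form (`q_w = r^{2l}`) and the VALUATION form
(`2l ∣ ord_w Δ_min(E_K)`) of Ex. 3.2 (iv) speak about the same integer.
(`w(q) = w(j)⁻¹`, `w(j(E_K)) = exp(ord_w Δ_min(E_K))` at a multiplicative place — Silverman AEC
VII.5.1 (b), the tree's `valuation_j_eq_exp_ordMinimalDiscriminant_of_hasMultiplicativeReductionAt`.)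
[claim: Mochizuki2012, status: disputed] [cite: SilvermanATAEC1994, Lemma V.5.1 and Thm. V.5.3 (PDF pp. 406–409)]
[cite: SilvermanAEC2009, Prop. VII.5.1(b)] -/
theorem log_valued_tateParameter_eq_neg_ordMinimalDiscriminant_of_liesOver {v : HeightOneSpectrum (𝓞 F)}
    (w : HeightOneSpectrum (𝓞 K)) [w.asIdeal.LiesOver v.asIdeal]
    (hmult : E.HasMultiplicativeReductionAt v) {q : w.adicCompletion K} (hq0 : q ≠ 0)
    (hq : Valued.v q < 1) (hqj : tateJ q = algebraMap K (w.adicCompletion K) (E.baseChange K).j) :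
    WithZero.log (Valued.v q) = -((E.baseChange K).ordMinimalDiscriminant w : ℤ) := by
  letI := Literature.NumberTheory.GaloisRepresentations.Ultrametric.AdicCompletion.nontriviallyNormedField K w
  haveI := charZero_adicCompletion' K w
  haveI : (E.baseChange K).IsElliptic := inferInstanceAs (E.map (algebraMap F K)).IsElliptic
  haveI : ((E.baseChange K).baseChange (w.adicCompletion K)).IsElliptic :=
    inferInstanceAs ((E.baseChange K).map (algebraMap K (w.adicCompletion K))).IsElliptic
  obtain ⟨q', hq0', hq', hqj', hv', -⟩ :=
    exists_tateParameter_valuation_of_hasSplitMultiplicativeReductionAt K w (E.baseChange K)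
      (D.hasSplitMultiplicativeReductionAt_of_liesOver w hmult)
  have hjE : ((E.baseChange K).baseChange (w.adicCompletion K)).j =
      algebraMap K (w.adicCompletion K) (E.baseChange K).j := (E.baseChange K).map_j _
  -- uniqueness of the Tate parameter (ATAEC Lemma V.5.1)
  have hqq : q = q' :=
    tateParameter_unique (E := (E.baseChange K).baseChange (w.adicCompletion K)) hq0
      (Valued.toNormedField.norm_lt_one_iff.mpr hq) (hqj.trans hjE.symm) hq0'
      (Valued.toNormedField.norm_lt_one_iff.mpr hq') (hqj'.trans hjE.symm)
  rw [hqq, hv', WeierstrassCurve.valued_algebraMap_adicCompletion,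
    (E.baseChange K).valuation_j_eq_exp_ordMinimalDiscriminant_of_hasMultiplicativeReductionAt w
      (D.hasMultiplicativeReductionAt_of_liesOver w hmult), ← WithZero.exp_neg, WithZero.log_exp]

end InitialThetaData

end ThetaData

end Literature.IUT.HodgeTheaters

end
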